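import Mathlib
import Summits.AtomisticToContinuum.Crystallization.Theses.PhononSlackCertificates
import Summits.AtomisticToContinuum.Crystallization.Theorems.PhononSlackCertificatesNearFieldConvexityStubCruxOfPureNearField
import Summits.AtomisticToContinuum.Crystallization.Theorems.PhononSlackCertificatesNearFieldConvexityStubInterfaceOfPairCount
import Summits.AtomisticToContinuum.Crystallization.Theorems.PhononSlackCertificatesNearFieldConvexityStubPairCountOfCrossing
import Summits.AtomisticToContinuum.Crystallization.Theorems.PhononSlackCertificatesNearFieldConvexityStubSelfSiteFloor
import Summits.AtomisticToContinuum.Crystallization.Theorems.PhononSlackCertificatesNearFieldConvexityStubFluxEnvelope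
import Summits.AtomisticToContinuum.Crystallization.Theorems.PhononSlackCertificatesNearFieldConvexityStubPnfOfLocalCertificate
import Summits.AtomisticToContinuum.Crystallization.Theorems.NearFieldConvexity.Negative.LoadBearing

/-!
# Birth skeleton (BC3) — crux `PhononSlackCertificates.NearFieldConvexity` (stmt-AtomisticToContinuum-13958)

Route `route-AtomisticToContinuum-PhononSlackCertificates`, sub-problem `Crystallization`; file
`Cruxes/NearFieldConvexity/Lines/birth.lean` (skeleton registrar, 2026-08-17).

## What is already Lean (imported, sorry-free, landed on the crux)
The line `Sketch` (leads -0 / c1) reduced the crux BY LANDED LEAN to one pointwise statement LC∞: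
`crux ⟸ PNF` (`stub_cruxOfPureNearField` p107126 ∘ interface chain `stub_interfaceOfPairCount` p106696 ∘
`stub_pairCountOfCrossing` p112085 — the far field and the cross terms with `Ωᶜ` are boundary-summable),
`PNF ⟸ LC∞` (`stub_pnfOfLocalCertificate` p115421 with `stub_selfSiteFloor` p114798 and
`stub_fluxEnvelope` p115024 — interior sum, antisymmetry, `r⁻⁶` flux into the collar).  LC∞ = "for every
`δ, η` there are `c > 0`, `M` such that every `δ`-separated `x` and every set `Ω` of `1/20`-good particles
carry an antisymmetric transfer `τ` inside `Ω` with `|τ i j| ≤ M·|x i − x j|⁻⁶` making the calibrated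
self-site excess `E_i + Σ_j τ i j` (`E_i = ½Σ_{j∈Ω∖i} V_LJ − e*`) `≥ 0` at every radius-4 interior site
of `Ω`, and `≥ c` where the 2-ball is not `η`-layered".

## This skeleton: LC∞ ⟸ GEOMETRY (S1) + ENERGY (S2) — two named stubs, proved composition
* `stub_coarseLayeredChart` (S1, geometric rigidity of two-shell order, size L; the lead's step N1):
  if every particle within distance `4` of `x i` is `1/20`-good (which is exactly the situation of a
  radius-4 interior site of a good set `Ω`), then the radius-2 ball of `x i` IS layered at the COARSE
  tolerance `1/3`: two-way `1/3`-matched, after a translation, with a rigid image of triangular layers of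
  spacing `a ∈ [47/50, 1]` in hole registry along a Hägg word with interlayer spacings in
  `[39a/50, 17a/20]` — the crux's own layeredness predicate with `1/3` in place of `η`.  No energy enters.
  Mechanism: an `h`-environment (anticuboctahedron) has a UNIQUE centred planar hexagon, a `c`-environment
  (cuboctahedron) has one parallel to each triangular face, so the layer normal of one good site propagates
  site-by-site through the good 4-ball (letters are constant on layers: adjacent in-plane sites share a
  mirror pair of neighbours); five consecutive layers meet the 2-ball, every ±1 letter sequence is a Hägg
  word; the tolerance budget (`1/20`-fits have affine misfit ≤ 0.035, lever arm 2, box clamping of the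
  spacings) is ≈ 0.2 < 1/3 < 0.42 = half the least particle separation, so the coarse chart is still a
  bijection particle ↔ template point on the ball.
* `stub_certificateOnCharts` (S2, the energy certificate, size XL; the lead's N2 + N3 + N5): LC∞ itself,
  but demanded only at interior sites whose 2-ball carries the coarse chart of S1 (an extra hypothesis per
  site): frame-free local calibration germ (certified LMI, kit j018792/j018936: λ ≈ +0.17 at two shells for
  fcc AND hcp, +0.03 at three shells), nonlinear closure on the Bregman-convex tube, `r⁻⁶` tail transferred
  along the far bonds.  The chart hands the prover the combinatorial frame (template, word, bijection) in
  which the cluster functionals `ẽ_s` are defined; the fine closeness is then paid for by the energy.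
* PROVED here (no sorry): `localCertificate_of_stubs : S1 → S2 → LC∞` (logic: at an interior site all
  particles within 4 are in `Ω`, hence good, so S1 supplies the chart S2 asks for) and the composition
  `NearFieldConvexity_of : Stmt.stub_coarseLayeredChart → Stmt.stub_certificateOnCharts → NearFieldConvexity`
  through the landed chain; `NearFieldConvexity_skeleton : NearFieldConvexity` instantiates it on the two
  sorried stubs (zero-hypothesis form).  `Stmt.stub_coarseLayeredChart` / `Stmt.stub_certificateOnCharts`
  are the two stub statements as `Prop` definitions carrying the stubs' own names (they unfold, by `rfl`,
  to the registered signatures of `stub_coarseLayeredChart` / `stub_certificateOnCharts`; an `example`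
  restates the composition with both signatures written out).

## Disproof.lean / Negative lemmas honoured (cdisprove cycle 1; `Negative/LoadBearing.lean` imported)
`nearFieldConvexity_false_without_separation`, `not_nearFieldConvexityUniform` (constants after `δ`),
`nearFieldConvexity_false_without_boundaryCharge`, `not_nearFieldConvexityRadius_of_lt_one`: all four are
about matter OUTSIDE `Ω` / the collar and are discharged by the landed chain (`C(δ) = c + (250/12)δ⁻⁶ +
250|M|δ⁻⁶ + …`, collar radius 4, separation kept as a hypothesis of both stubs); S1/S2 only speak about
the self-energy of `Ω` and the geometry of good balls.  The comb witness (`Negative/Comb.lean`) does not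
instantiate either stub: its 18 pattern particles are surface particles, hence BAD and outside any good
`Ω`, and they lie within `√2 < 4` of the centre — so the centre is neither a site with an all-good 4-ball
(S1's hypothesis) nor a radius-4 interior site of `Ω = {centre}` (S2's).  `c = c(η) ≲ μη²` (paper
obstruction (a)) is respected: S2 chooses `c` after `η`; the collar radius stays `4 ≥ 1` (tightness (b)).

## Not cheap (BC3 probes, file `bc/NearFieldConvexity_birth_probes.lean`, rc and goals in NOTES.md)
`S1 → crux`, `S1 → Crystallization`, `S2 → crux`, `S2 → Crystallization` by
`first | exact? | simpa | aesop` all FAIL: S1 has no energy in it; S2 lacks the chart at uncharted interior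
sites, which only S1 (or a proof of it) provides.
-/

noncomputable section

open scoped BigOperators
open Literature.MathematicalPhysics.StatisticalMechanics Literature.Geometry.DiscreteGeometry

namespace Summit.AtomisticToContinuum.Crystallization.Cruxes.NearFieldConvexity.Birth

open Summit.AtomisticToContinuum.Crystallization.Theorems.PhononSlackNearFieldConvexity

/-! ## The two stub STATEMENTS (`Prop` defs `Stmt.<stub name>`; the registered stubs below restate them verbatim) -/

/-- **Statement of stub S1 — coarse layered chart** (geometric rigidity of two-shell order): a particle all of whose
neighbours within distance `4` are `1/20`-good has a `1/3`-layered radius-2 ball (the crux's layeredness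
predicate at tolerance `1/3`).  [folklore shape; cf. HalesDSP2012 §1.3 (exact version: Barlow layer
packings), lead's N1] -/
def Stmt.stub_coarseLayeredChart : Prop :=
  ∀ δ : ℝ, 0 < δ → ∀ (N : ℕ) (x : Fin N → EuclideanSpace ℝ (Fin 3)),
      (∀ i j : Fin N, i ≠ j → δ ≤ dist (x i) (x j)) →
      ∀ i : Fin N, (∀ j : Fin N, dist (x j) (x i) ≤ 4 → IsTwoShellGood (1 / 20) (47 / 50) 1 x j) →
        (∃ (A : EuclideanSpace ℝ (Fin 3) →ₗᵢ[ℝ] EuclideanSpace ℝ (Fin 3)) (t : EuclideanSpace ℝ (Fin 3)) (a : ℝ) (s : ℤ → ℤ) (z : ℤ → ℝ), 47 / 50 ≤ a ∧ a ≤ 1 ∧ IsHaggSeq s ∧ (∀ m : ℤ, 39 / 50 * a ≤ z (m + 1) - z m ∧ z (m + 1) - z m ≤ 17 / 20 * a) ∧ (fun S : Set (EuclideanSpace ℝ (Fin 3)) => (∀ j : Fin N, dist (x j) (x i) ≤ 2 → ∃ p ∈ S, dist (x j + t) p ≤ 1 / 3) ∧ (∀ p ∈ S, dist p (x i + t) ≤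 2 → ∃ j : Fin N, dist (x j + t) p ≤ 1 / 3)) {p | ∃ m i j : ℤ, p = A (((i : ℝ) • triangularVec₁ a) + ((j : ℝ) • triangularVec₂ a) + ((haggLabel s m : ℝ) • barlowOffset a) + (z m • layerNormal 1))})

/-- **Statement of stub S2 — local certificate on coarse charts** (the energy content: LC∞ of line `Sketch` demanded only
at interior sites carrying the coarse chart of S1). [cards frame-free-star-certificate; EMing2006,
FrieseckeTheil2002, AyalaChoksiWirth2025 for the germ; kit j018792/j018936] -/
def Stmt.stub_certificateOnCharts : Prop :=
  ∀ δ : ℝ, 0 < δ → ∀ η : ℝ, 0 < η → ∃ c : ℝ, 0 < c ∧ ∃ M : ℝ, ∀ (N : ℕ) (x : Fin N → EuclideanSpace ℝ (Fin 3)),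
      (∀ i j : Fin N, i ≠ j → δ ≤ dist (x i) (x j)) →
      ∀ Ω : Finset (Fin N), (∀ i ∈ Ω, IsTwoShellGood (1 / 20) (47 / 50) 1 x i) →
        ∃ τ : Fin N → Fin N → ℝ, (∀ i j, τ i j = -τ j i) ∧ (∀ i j, |τ i j| ≤ M * (dist (x i) (x j))⁻¹ ^ 6) ∧
          ∀ i ∈ Ω, (∀ k : Fin N, dist (x k) (x i) ≤ 4 → k ∈ Ω) →
            (∃ (A : EuclideanSpace ℝ (Fin 3) →ₗᵢ[ℝ] EuclideanSpace ℝ (Fin 3)) (t : EuclideanSpace ℝ (Fin 3)) (a : ℝ) (s : ℤ → ℤ) (z : ℤ → ℝ), 47 / 50 ≤ a ∧ a ≤ 1 ∧ IsHaggSeq s ∧ (∀ m : ℤ, 39 / 50 * a ≤ z (m + 1) - z m ∧ z (m + 1) - z m ≤ 17 / 20 * a) ∧ (fun S : Set (EuclideanSpace ℝ (Fin 3)) => (∀ j : Fin N, dist (x j) (x i) ≤ 2 → ∃ p ∈ S, dist (x j + t) p ≤ 1 / 3) ∧ (∀ p ∈ S, dist p (x i + t) ≤ 2 → ∃ j : Fin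 N, dist (x j + t) p ≤ 1 / 3)) {p | ∃ m i j : ℤ, p = A (((i : ℝ) • triangularVec₁ a) + ((j : ℝ) • triangularVec₂ a) + ((haggLabel s m : ℝ) • barlowOffset a) + (z m • layerNormal 1))}) →
            0 ≤ ((1 / 2 : ℝ) * (∑ j ∈ Ω.erase i, lennardJones (dist (x i) (x j))) - (⨅ Q : PeriodicConfiguration 3, Q.energyPerParticle lennardJones)) + ∑ j ∈ Ω, τ i j ∧
            (¬ (∃ (A : EuclideanSpace ℝ (Fin 3) →ₗᵢ[ℝ] EuclideanSpace ℝ (Fin 3)) (t : EuclideanSpace ℝ (Fin 3)) (a : ℝ) (s : ℤ → ℤ) (z : ℤ → ℝ), 47 / 50 ≤ a ∧ a ≤ 1 ∧ IsHaggSeq s ∧ (∀ m : ℤ, 39 / 50 * a ≤ z (m + 1) - z m ∧ z (m + 1) - z m ≤ 17 / 20 * a) ∧ (fun S : Set (EuclideanSpace ℝ (Fin 3)) => (∀ j : Fin N, dist (x j) (x i) ≤ 2 → ∃ p ∈ S, dist (x j + t) p ≤ η) ∧ (∀ p ∈ S, dist p (x i + t) ≤ 2 → ∃ j : Fin N, dist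 (x j + t) p ≤ η)) {p | ∃ m i j : ℤ, p = A (((i : ℝ) • triangularVec₁ a) + ((j : ℝ) • triangularVec₂ a) + ((haggLabel s m : ℝ) • barlowOffset a) + (z m • layerNormal 1))}) →
              c ≤ ((1 / 2 : ℝ) * (∑ j ∈ Ω.erase i, lennardJones (dist (x i) (x j))) - (⨅ Q : PeriodicConfiguration 3, Q.energyPerParticle lennardJones)) + ∑ j ∈ Ω, τ i j)

/-! ## The registered stubs (the ONLY sorries of this file) -/

/-- **Stub S1** (geometric, size L): the statement `Stmt.stub_coarseLayeredChart`, written out. -/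
theorem stub_coarseLayeredChart :
    ∀ δ : ℝ, 0 < δ → ∀ (N : ℕ) (x : Fin N → EuclideanSpace ℝ (Fin 3)),
      (∀ i j : Fin N, i ≠ j → δ ≤ dist (x i) (x j)) →
      ∀ i : Fin N, (∀ j : Fin N, dist (x j) (x i) ≤ 4 → IsTwoShellGood (1 / 20) (47 / 50) 1 x j) →
        (∃ (A : EuclideanSpace ℝ (Fin 3) →ₗᵢ[ℝ] EuclideanSpace ℝ (Fin 3)) (t : EuclideanSpace ℝ (Fin 3)) (a : ℝ) (s : ℤ → ℤ) (z : ℤ → ℝ), 47 / 50 ≤ a ∧ a ≤ 1 ∧ IsHaggSeq s ∧ (∀ m : ℤ, 39 / 50 * a ≤ z (m + 1) - z m ∧ z (m + 1) - z m ≤ 17 / 20 * a) ∧ (fun S : Set (EuclideanSpace ℝ (Fin 3)) => (∀ j : Fin N, dist (x j) (x i) ≤ 2 → ∃ p ∈ S, dist (x j + t) p ≤ 1 / 3) ∧ (∀ p ∈ S, dist p (x i + t) ≤ 2 → ∃ j : Fin N, dist (x j + t) p ≤ 1 / 3)) {p | ∃ m i j : ℤ, p = A (((i : ℝ) • triangularVec₁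 a) + ((j : ℝ) • triangularVec₂ a) + ((haggLabel s m : ℝ) • barlowOffset a) + (z m • layerNormal 1))}) := by
  sorry

/-- **Stub S2** (energy certificate, size XL): the statement `Stmt.stub_certificateOnCharts`, written out. -/
theorem stub_certificateOnCharts :
    ∀ δ : ℝ, 0 < δ → ∀ η : ℝ, 0 < η → ∃ c : ℝ, 0 < c ∧ ∃ M : ℝ, ∀ (N : ℕ) (x : Fin N → EuclideanSpace ℝ (Fin 3)),
      (∀ i j : Fin N, i ≠ j → δ ≤ dist (x i) (x j)) →
      ∀ Ω : Finset (Fin N), (∀ i ∈ Ω, IsTwoShellGood (1 / 20) (47 / 50) 1 x i) →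
        ∃ τ : Fin N → Fin N → ℝ, (∀ i j, τ i j = -τ j i) ∧ (∀ i j, |τ i j| ≤ M * (dist (x i) (x j))⁻¹ ^ 6) ∧
          ∀ i ∈ Ω, (∀ k : Fin N, dist (x k) (x i) ≤ 4 → k ∈ Ω) →
            (∃ (A : EuclideanSpace ℝ (Fin 3) →ₗᵢ[ℝ] EuclideanSpace ℝ (Fin 3)) (t : EuclideanSpace ℝ (Fin 3)) (a : ℝ) (s : ℤ → ℤ) (z : ℤ → ℝ), 47 / 50 ≤ a ∧ a ≤ 1 ∧ IsHaggSeq s ∧ (∀ m : ℤ, 39 / 50 * a ≤ z (m + 1) - z m ∧ z (m + 1) - z m ≤ 17 / 20 * a) ∧ (fun S : Set (EuclideanSpace ℝ (Fin 3)) => (∀ j : Fin N, dist (x j) (x i) ≤ 2 → ∃ p ∈ S, dist (x j + t) p ≤ 1 / 3) ∧ (∀ p ∈ S, dist p (x i + t) ≤ 2 → ∃ j : Fin N, dist (x j + t) p ≤ 1 / 3)) {p | ∃ m i j : ℤ, p = A (((i : ℝ) • triangularVec₁ a) + ((j : ℝ) • triangularVec₂ a) + ((haggLabel s m : ℝ)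 • barlowOffset a) + (z m • layerNormal 1))}) →
            0 ≤ ((1 / 2 : ℝ) * (∑ j ∈ Ω.erase i, lennardJones (dist (x i) (x j))) - (⨅ Q : PeriodicConfiguration 3, Q.energyPerParticle lennardJones)) + ∑ j ∈ Ω, τ i j ∧
            (¬ (∃ (A : EuclideanSpace ℝ (Fin 3) →ₗᵢ[ℝ] EuclideanSpace ℝ (Fin 3)) (t : EuclideanSpace ℝ (Fin 3)) (a : ℝ) (s : ℤ → ℤ) (z : ℤ → ℝ), 47 / 50 ≤ a ∧ a ≤ 1 ∧ IsHaggSeq s ∧ (∀ m : ℤ, 39 / 50 * a ≤ z (m + 1) - z m ∧ z (m + 1) - z m ≤ 17 / 20 * a) ∧ (fun S : Set (EuclideanSpace ℝ (Fin 3)) => (∀ j : Fin N, dist (x j) (x i) ≤ 2 → ∃ p ∈ S, dist (x j + t) p ≤ η) ∧ (∀ p ∈ S, dist p (x i + t) ≤ 2 → ∃ j : Fin N, dist (x j + t) p ≤ η)) {p | ∃ m i j : ℤ, p = A (((i : ℝ) • triangularVec₁ a) + ((j : ℝ) • triangularVec₂ a) + ((haggLabel s m : ℝ) • barlowOffset a)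 + (z m • layerNormal 1))}) →
              c ≤ ((1 / 2 : ℝ) * (∑ j ∈ Ω.erase i, lennardJones (dist (x i) (x j))) - (⨅ Q : PeriodicConfiguration 3, Q.energyPerParticle lennardJones)) + ∑ j ∈ Ω, τ i j) := by
  sorry

/-- The defs ARE the stub signatures (definitional unfolding). -/
example : Stmt.stub_coarseLayeredChart = (∀ δ : ℝ, 0 < δ → ∀ (N : ℕ) (x : Fin N → EuclideanSpace ℝ (Fin 3)),
      (∀ i j : Fin N, i ≠ j → δ ≤ dist (x i) (x j)) →
      ∀ i : Fin N, (∀ j : Fin N, dist (x j) (x i) ≤ 4 → IsTwoShellGood (1 / 20) (47 / 50) 1 x j) →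
        (∃ (A : EuclideanSpace ℝ (Fin 3) →ₗᵢ[ℝ] EuclideanSpace ℝ (Fin 3)) (t : EuclideanSpace ℝ (Fin 3)) (a : ℝ) (s : ℤ → ℤ) (z : ℤ → ℝ), 47 / 50 ≤ a ∧ a ≤ 1 ∧ IsHaggSeq s ∧ (∀ m : ℤ, 39 / 50 * a ≤ z (m + 1) - z m ∧ z (m + 1) - z m ≤ 17 / 20 * a) ∧ (fun S : Set (EuclideanSpace ℝ (Fin 3)) => (∀ j : Fin N, dist (x j) (x i) ≤ 2 → ∃ p ∈ S, dist (x j + t) p ≤ 1 / 3) ∧ (∀ p ∈ S, dist p (x i + t) ≤ 2 → ∃ j : Fin N, dist (x j + t) p ≤ 1 / 3)) {p | ∃ m i j : ℤ, p = A (((i : ℝ) • triangularVec₁ a) + ((j : ℝ) • triangularVec₂ a) + ((haggLabel s m : ℝ) • barlowOffset a) + (z m • layerNormal 1))})) := rfl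

example : Stmt.stub_certificateOnCharts = (∀ δ : ℝ, 0 < δ → ∀ η : ℝ, 0 < η → ∃ c : ℝ, 0 < c ∧ ∃ M : ℝ, ∀ (N : ℕ) (x : Fin N → EuclideanSpace ℝ (Fin 3)),
      (∀ i j : Fin N, i ≠ j → δ ≤ dist (x i) (x j)) →
      ∀ Ω : Finset (Fin N), (∀ i ∈ Ω, IsTwoShellGood (1 / 20) (47 / 50) 1 x i) →
        ∃ τ : Fin N → Fin N → ℝ, (∀ i j, τ i j = -τ j i) ∧ (∀ i j, |τ i j| ≤ M * (dist (x i) (x j))⁻¹ ^ 6) ∧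
          ∀ i ∈ Ω, (∀ k : Fin N, dist (x k) (x i) ≤ 4 → k ∈ Ω) →
            (∃ (A : EuclideanSpace ℝ (Fin 3) →ₗᵢ[ℝ] EuclideanSpace ℝ (Fin 3)) (t : EuclideanSpace ℝ (Fin 3)) (a : ℝ) (s : ℤ → ℤ) (z : ℤ → ℝ), 47 / 50 ≤ a ∧ a ≤ 1 ∧ IsHaggSeq s ∧ (∀ m : ℤ, 39 / 50 * a ≤ z (m + 1) - z m ∧ z (m + 1) - z m ≤ 17 / 20 * a) ∧ (fun S : Set (EuclideanSpace ℝ (Fin 3)) => (∀ j : Fin N, dist (x j) (x i) ≤ 2 → ∃ p ∈ S, dist (x j + t) p ≤ 1 / 3) ∧ (∀ p ∈ S, dist p (x i + t) ≤ 2 → ∃ j : Fin N, dist (x j + t) p ≤ 1 / 3)) {p | ∃ m i j : ℤ, p = A (((i : ℝ) • triangularVec₁ a) + ((j : ℝ) • triangularVec₂ a) + ((haggLabel s m : ℝ) • barlowOffset a) + (z m • layerNormal 1))}) →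
            0 ≤ ((1 / 2 : ℝ) * (∑ j ∈ Ω.erase i, lennardJones (dist (x i) (x j))) - (⨅ Q : PeriodicConfiguration 3, Q.energyPerParticle lennardJones)) + ∑ j ∈ Ω, τ i j ∧
            (¬ (∃ (A : EuclideanSpace ℝ (Fin 3) →ₗᵢ[ℝ] EuclideanSpace ℝ (Fin 3)) (t : EuclideanSpace ℝ (Fin 3)) (a : ℝ) (s : ℤ → ℤ) (z : ℤ → ℝ), 47 / 50 ≤ a ∧ a ≤ 1 ∧ IsHaggSeq s ∧ (∀ m : ℤ, 39 / 50 * a ≤ z (m + 1) - z m ∧ z (m + 1) - z m ≤ 17 / 20 * a) ∧ (fun S : Set (EuclideanSpace ℝ (Fin 3)) => (∀ j : Fin N, dist (x j) (x i) ≤ 2 → ∃ p ∈ S, dist (x j + t) p ≤ η) ∧ (∀ p ∈ S, dist p (x i + t) ≤ 2 → ∃ j : Fin N, dist (x j + t) p ≤ η)) {p | ∃ m i j : ℤ, p = A (((i : ℝ) • triangularVec₁ a) + ((j : ℝ) • triangularVec₂ a) + ((haggLabel s m : ℝ) • barlowOffset a) + (z m • layerNormal 1))}) →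
              c ≤ ((1 / 2 : ℝ) * (∑ j ∈ Ω.erase i, lennardJones (dist (x i) (x j))) - (⨅ Q : PeriodicConfiguration 3, Q.energyPerParticle lennardJones)) + ∑ j ∈ Ω, τ i j)) := rfl

/-! ## The proved composition -/

/-- **Glue (proved): S1 + S2 ⟹ LC∞** (the registered `stub_localCertificate` of line `Sketch`, i.e. the
hypothesis `hLC` of the landed `stub_pnfOfLocalCertificate`).  At a radius-4 interior site `i` of `Ω`
every particle within `4` of `x i` lies in `Ω`, hence is good, so S1 supplies the coarse chart that S2
asks for; the transfer, its antisymmetry and its envelope are S2's. -/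
theorem localCertificate_of_stubs (h₁ : Stmt.stub_coarseLayeredChart) (h₂ : Stmt.stub_certificateOnCharts) :
    ∀ δ : ℝ, 0 < δ → ∀ η : ℝ, 0 < η → ∃ c : ℝ, 0 < c ∧ ∃ M : ℝ, ∀ (N : ℕ) (x : Fin N → EuclideanSpace ℝ (Fin 3)),
      (∀ i j : Fin N, i ≠ j → δ ≤ dist (x i) (x j)) →
      ∀ Ω : Finset (Fin N), (∀ i ∈ Ω, IsTwoShellGood (1 / 20) (47 / 50) 1 x i) →
        ∃ τ : Fin N → Fin N → ℝ, (∀ i j, τ i j = -τ j i) ∧ (∀ i j, |τ i j| ≤ M * (dist (x i) (x j))⁻¹ ^ 6) ∧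
          ∀ i ∈ Ω, (∀ k : Fin N, dist (x k) (x i) ≤ 4 → k ∈ Ω) →
            0 ≤ ((1 / 2 : ℝ) * (∑ j ∈ Ω.erase i, lennardJones (dist (x i) (x j))) - (⨅ Q : PeriodicConfiguration 3, Q.energyPerParticle lennardJones)) + ∑ j ∈ Ω, τ i j ∧
            (¬ (∃ (A : EuclideanSpace ℝ (Fin 3) →ₗᵢ[ℝ] EuclideanSpace ℝ (Fin 3)) (t : EuclideanSpace ℝ (Fin 3)) (a : ℝ) (s : ℤ → ℤ) (z : ℤ → ℝ), 47 / 50 ≤ a ∧ a ≤ 1 ∧ IsHaggSeq s ∧ (∀ m : ℤ, 39 / 50 * a ≤ z (m + 1) - z m ∧ z (m + 1) - z m ≤ 17 / 20 * a) ∧ (fun S : Set (EuclideanSpace ℝ (Fin 3)) => (∀ j : Fin N, dist (x j) (x i) ≤ 2 → ∃ p ∈ S, dist (x j + t) p ≤ η) ∧ (∀ p ∈ S, dist p (x i + t) ≤ 2 → ∃ j : Fin N, dist (x j + t) p ≤ η)) {p | ∃ m i j : ℤ, p = A (((i : ℝ) • triangularVec₁ a) + ((j : ℝ) • triangularVec₂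 a) + ((haggLabel s m : ℝ) • barlowOffset a) + (z m • layerNormal 1))}) →
              c ≤ ((1 / 2 : ℝ) * (∑ j ∈ Ω.erase i, lennardJones (dist (x i) (x j))) - (⨅ Q : PeriodicConfiguration 3, Q.energyPerParticle lennardJones)) + ∑ j ∈ Ω, τ i j) := by
  intro δ hδ η hη
  obtain ⟨c, hc, M, hM⟩ := h₂ δ hδ η hη
  refine ⟨c, hc, M, ?_⟩
  intro N x hsep Ω hΩ
  obtain ⟨τ, hτa, hτM, hpt⟩ := hM N x hsep Ω hΩ
  refine ⟨τ, hτa, hτM, ?_⟩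
  intro i hi hint
  exact hpt i hi hint (h₁ δ hδ N x hsep i (fun j hj => hΩ j (hint j hj)))

/-- The INTERFACE LEMMA of line `Sketch` (landed chain, restated: `Σ_{i∈int₄Ω} Σ_{j∉Ω} r⁻⁶ ≤ K(δ)·#∂₄Ω`). -/
theorem interfaceLemma :
    ∀ δ : ℝ, 0 < δ → ∃ K : ℝ, ∀ (N : ℕ) (x : Fin N → EuclideanSpace ℝ (Fin 3)),
      (∀ i j : Fin N, i ≠ j → δ ≤ dist (x i) (x j)) →
      ∀ Ω : Finset (Fin N), (∀ i ∈ Ω, IsTwoShellGood (1 / 20) (47 / 50) 1 x i) →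
        (∑ i ∈ Ω.filter (fun i => ∀ j : Fin N, dist (x j) (x i) ≤ 4 → j ∈ Ω),
            ∑ j ∈ Finset.univ.filter (fun j => j ∉ Ω), (dist (x i) (x j))⁻¹ ^ 6) ≤
          K * (Nat.card {i : Fin N // i ∈ Ω ∧ ∃ j : Fin N, j ∉ Ω ∧ dist (x j) (x i) ≤ 4} : ℝ) :=
  stub_interfaceOfPairCount stub_pairCountOfCrossing

/-- **COMPOSITION (proved, no sorry): the two stub statements imply the crux BY NAME**, through the landed
chain `stub_cruxOfPureNearField ∘ stub_pnfOfLocalCertificate (stub_selfSiteFloor, stub_fluxEnvelope, ·)`. -/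
theorem NearFieldConvexity_of :
    Stmt.stub_coarseLayeredChart → Stmt.stub_certificateOnCharts → Summit.AtomisticToContinuum.Crystallization.Theses.PhononSlackCertificates.NearFieldConvexity :=
  fun h₁ h₂ =>
    stub_cruxOfPureNearField interfaceLemma
      (stub_pnfOfLocalCertificate stub_selfSiteFloor stub_fluxEnvelope (localCertificate_of_stubs h₁ h₂))

/-- The same composition with the stub signatures written out (it is `NearFieldConvexity_of` verbatim). -/
example :
    (∀ δ : ℝ, 0 < δ → ∀ (N : ℕ) (x : Fin N → EuclideanSpace ℝ (Fin 3)),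
      (∀ i j : Fin N, i ≠ j → δ ≤ dist (x i) (x j)) →
      ∀ i : Fin N, (∀ j : Fin N, dist (x j) (x i) ≤ 4 → IsTwoShellGood (1 / 20) (47 / 50) 1 x j) →
        (∃ (A : EuclideanSpace ℝ (Fin 3) →ₗᵢ[ℝ] EuclideanSpace ℝ (Fin 3)) (t : EuclideanSpace ℝ (Fin 3)) (a : ℝ) (s : ℤ → ℤ) (z : ℤ → ℝ), 47 / 50 ≤ a ∧ a ≤ 1 ∧ IsHaggSeq s ∧ (∀ m : ℤ, 39 / 50 * a ≤ z (m + 1) - z m ∧ z (m + 1) - z m ≤ 17 / 20 * a) ∧ (fun S : Set (EuclideanSpace ℝ (Fin 3)) => (∀ j : Fin N, dist (x j) (x i) ≤ 2 → ∃ p ∈ S, dist (x j + t) p ≤ 1 / 3) ∧ (∀ p ∈ S, dist p (x i + t) ≤ 2 → ∃ j : Fin N, dist (x j + t) p ≤ 1 / 3)) {p | ∃ m i j : ℤ, p = A (((i : ℝ) • triangularVec₁ a) + ((j : ℝ) • triangularVec₂ a) + ((haggLabel s m : ℝ) • barlowOffset a) + (z m • layerNormal 1))})) →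
    (∀ δ : ℝ, 0 < δ → ∀ η : ℝ, 0 < η → ∃ c : ℝ, 0 < c ∧ ∃ M : ℝ, ∀ (N : ℕ) (x : Fin N → EuclideanSpace ℝ (Fin 3)),
      (∀ i j : Fin N, i ≠ j → δ ≤ dist (x i) (x j)) →
      ∀ Ω : Finset (Fin N), (∀ i ∈ Ω, IsTwoShellGood (1 / 20) (47 / 50) 1 x i) →
        ∃ τ : Fin N → Fin N → ℝ, (∀ i j, τ i j = -τ j i) ∧ (∀ i j, |τ i j| ≤ M * (dist (x i) (x j))⁻¹ ^ 6) ∧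
          ∀ i ∈ Ω, (∀ k : Fin N, dist (x k) (x i) ≤ 4 → k ∈ Ω) →
            (∃ (A : EuclideanSpace ℝ (Fin 3) →ₗᵢ[ℝ] EuclideanSpace ℝ (Fin 3)) (t : EuclideanSpace ℝ (Fin 3)) (a : ℝ) (s : ℤ → ℤ) (z : ℤ → ℝ), 47 / 50 ≤ a ∧ a ≤ 1 ∧ IsHaggSeq s ∧ (∀ m : ℤ, 39 / 50 * a ≤ z (m + 1) - z m ∧ z (m + 1) - z m ≤ 17 / 20 * a) ∧ (fun S : Set (EuclideanSpace ℝ (Fin 3)) => (∀ j : Fin N, dist (x j) (x i) ≤ 2 → ∃ p ∈ S, dist (x j + t) p ≤ 1 / 3) ∧ (∀ p ∈ S, dist p (x i + t) ≤ 2 → ∃ j : Fin N, dist (x j + t) p ≤ 1 / 3)) {p | ∃ m i j : ℤ, p = A (((i : ℝ) • triangularVec₁ a) + ((j : ℝ) • triangularVec₂ a) + ((haggLabel s m : ℝ) • barlowOffset a) + (z m • layerNormal 1))}) →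
            0 ≤ ((1 / 2 : ℝ) * (∑ j ∈ Ω.erase i, lennardJones (dist (x i) (x j))) - (⨅ Q : PeriodicConfiguration 3, Q.energyPerParticle lennardJones)) + ∑ j ∈ Ω, τ i j ∧
            (¬ (∃ (A : EuclideanSpace ℝ (Fin 3) →ₗᵢ[ℝ] EuclideanSpace ℝ (Fin 3)) (t : EuclideanSpace ℝ (Fin 3)) (a : ℝ) (s : ℤ → ℤ) (z : ℤ → ℝ), 47 / 50 ≤ a ∧ a ≤ 1 ∧ IsHaggSeq s ∧ (∀ m : ℤ, 39 / 50 * a ≤ z (m + 1) - z m ∧ z (m + 1) - z m ≤ 17 / 20 * a) ∧ (fun S : Set (EuclideanSpace ℝ (Fin 3)) => (∀ j : Fin N, dist (x j) (x i) ≤ 2 → ∃ p ∈ S, dist (x j + t) p ≤ η) ∧ (∀ p ∈ S, dist p (x i + t) ≤ 2 → ∃ j : Fin N, dist (x j + t) p ≤ η)) {p | ∃ m i j : ℤ, p = A (((i : ℝ) • triangularVec₁ a) + ((j : ℝ) • triangularVec₂ a) + ((haggLabel s m : ℝ) • barlowOffset a) + (z m • layerNormal 1))}) →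
              c ≤ ((1 / 2 : ℝ) * (∑ j ∈ Ω.erase i, lennardJones (dist (x i) (x j))) - (⨅ Q : PeriodicConfiguration 3, Q.energyPerParticle lennardJones)) + ∑ j ∈ Ω, τ i j)) →
    Summit.AtomisticToContinuum.Crystallization.Theses.PhononSlackCertificates.NearFieldConvexity :=
  NearFieldConvexity_of

/-- **Skeleton instance** (zero hypotheses; its only sorries are inside the two registered stubs):
the crux by name from `stub_coarseLayeredChart` and `stub_certificateOnCharts`. -/
theorem NearFieldConvexity_skeleton : Summit.AtomisticToContinuum.Crystallization.Theses.PhononSlackCertificates.NearFieldConvexity :=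
  NearFieldConvexity_of stub_coarseLayeredChart stub_certificateOnCharts

end Summit.AtomisticToContinuum.Crystallization.Cruxes.NearFieldConvexity.Birth

end
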